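import Summits.ResolutionOfSingularities.ResolutionOfSingularities.Theorems.RadicialJungCleanModelsAlgebraizeDimTwoPrep
import Literature.AlgebraicGeometry.Resolution.AlterationsDimension
import HarnessLib

/-!
# The glued model of the dimension-2 `F`-finite cut is again a regular integral model
(crux `CleanModels`, line `Sketch` rev 10)

Route `ResolutionOfSingularities/RadicialJung`, crux item `CleanModels`
(stmt-ResolutionOfSingularities-15917), line `Sketch` rev 10 (lead c2), stub
`stub_principalizationDimTwoFFinite`. After Giraud's chart `X' → D'` has been patched into the
current model `V` by `stub_glueLocalModification` (output: `ρ : V' → V` proper, an open immersion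
`e : X' → V'` whose image is `ρ⁻¹(D')`, `ρ` an isomorphism over an open `O = V ∖ Z ⊇ V ∖ D'`),
the new scheme `V'` is covered by the image of `e` and the open `ρ⁻¹(O) ≅ O`. This file proves
from that covering alone:

* `subset_closure_inter_of_isPreirreducible` — an irreducible set lies in the closure of its
  trace on any open set it meets;
* `isIntegral_glue` — `V'` is integral (reduced stalk by stalk; irreducible because the two
  irreducible pieces meet);
* `isRegular_glue` — `V'` is regular (its stalks are stalks of `X'` or of `V`);
* `topologicalKrullDim_glue` — `dim V' = dim V` (both contain a copy of the non-empty open `O`,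
  and non-empty opens of integral schemes locally of finite type over a field have full
  dimension).
-/

noncomputable section

set_option linter.dupNamespace false -- mandated namespace of this single-conjunct summit

open CategoryTheory AlgebraicGeometry TopologicalSpace IsLocalRing
open Literature.AlgebraicGeometry.Resolution Literature.AlgebraicGeometry.Motives

namespace Summit.ResolutionOfSingularities.ResolutionOfSingularities.Theorems.RadicialJung.CleanModels

universe u

/-- An irreducible (pre-irreducible) set lies in the closure of its trace on any open set meeting
it. [folklore] -/
theorem subset_closure_inter_of_isPreirreducible {X : Type*} [TopologicalSpace X] {B A : Set X}
    (hB : IsPreirreducible B) (hA : IsOpen A) (hAB : (B ∩ A).Nonempty) : B ⊆ closure (B ∩ A) := by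
  intro x hx
  rw [mem_closure_iff]
  intro N hN hxN
  have h : (B ∩ (A ∩ N)).Nonempty := hB A N hA hN hAB ⟨x, hx, hxN⟩
  obtain ⟨y, hyB, hyA, hyN⟩ := h
  exact ⟨y, hyN, hyB, hyA⟩

/-- Points of the open `ρ⁻¹(O)`, over which `ρ` is an isomorphism, have the stalks of `V`. -/
theorem isIso_stalkMap_glue {V V' : Scheme.{u}} (ρ : V' ⟶ V) (O : V.Opens) [IsIso (ρ ∣_ O)]
    (v' : V') (hv' : ρ.base v' ∈ O) : IsIso (ρ.stalkMap v') :=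
  isIso_stalkMap_of_mem ρ O v' hv'

/-- **The glued scheme is integral**: if `V'` is covered by the image of an open immersion
`e : X' → V'` from an integral scheme and by an open `ρ⁻¹(O)` over which `ρ : V' → V` (`V`
integral) is an isomorphism, and the two pieces meet, then `V'` is integral. [folklore] -/
theorem isIntegral_glue {V V' X' : Scheme.{u}} (ρ : V' ⟶ V) (e : X' ⟶ V') [IsOpenImmersion e]
    (O : V.Opens) [IsIso (ρ ∣_ O)] [IsIntegral V] [IsIntegral X']
    (hcover : ∀ v' : V', v' ∈ Set.range e.base ∨ ρ.base v' ∈ O)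
    (hmeet : ∃ x' : X', ρ.base (e.base x') ∈ O) : IsIntegral V' := by
  obtain ⟨x₀, hx₀⟩ := hmeet
  haveI : Nonempty V' := ⟨e.base x₀⟩
  -- reduced: stalk by stalk
  haveI : ∀ v' : V', _root_.IsReduced (V'.presheaf.stalk v') := by
    intro v'
    rcases hcover v' with ⟨x', rfl⟩ | hv'
    · exact isReduced_of_injective (asIso (e.stalkMap x')).commRingCatIsoToRingEquiv.toRingHom
        (asIso (e.stalkMap x')).commRingCatIsoToRingEquiv.injective
    · haveI := isIso_stalkMap_glue ρ O v' hv'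
      exact isReduced_of_injective (asIso (ρ.stalkMap v')).commRingCatIsoToRingEquiv.symm.toRingHom
        (asIso (ρ.stalkMap v')).commRingCatIsoToRingEquiv.symm.injective
  haveI : IsReduced V' := isReduced_of_isReduced_stalk V'
  -- irreducible: the two irreducible pieces `range e` and `ρ⁻¹(O)` meet
  have hA : IsIrreducible (Set.range e.base) := by
    rw [← Set.image_univ]
    exact (IrreducibleSpace.isIrreducible_univ X').image _ e.base.hom.continuous.continuousOn
  have hO' : (O : Set V).Nonempty := ⟨_, hx₀⟩
  haveI : Nonempty (O : Scheme.{u}) := ⟨⟨_, hx₀⟩⟩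
  haveI : IsIntegral (O : Scheme.{u}) := isIntegral_of_isOpenImmersion O.ι
  haveI : Nonempty ((ρ ⁻¹ᵁ O : V'.Opens) : Scheme.{u}) := ⟨⟨e.base x₀, hx₀⟩⟩
  haveI : IsIntegral ((ρ ⁻¹ᵁ O : V'.Opens) : Scheme.{u}) := isIntegral_of_isOpenImmersion (ρ ∣_ O)
  have hB : IsIrreducible ((ρ ⁻¹ᵁ O : V'.Opens) : Set V') := by
    have h := (IrreducibleSpace.isIrreducible_univ ((ρ ⁻¹ᵁ O : V'.Opens) : Scheme.{u})).image _
      (ρ ⁻¹ᵁ O).ι.base.hom.continuous.continuousOn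
    rwa [Set.image_univ, Scheme.Opens.range_ι] at h
  have hBA : ((ρ ⁻¹ᵁ O : V'.Opens) : Set V') ⊆ closure (Set.range e.base) := by
    refine (subset_closure_inter_of_isPreirreducible hB.isPreirreducible e.isOpenEmbedding.isOpen_range
      ⟨e.base x₀, hx₀, x₀, rfl⟩).trans (closure_mono Set.inter_subset_right)
  have hdense : closure (Set.range e.base) = Set.univ := by
    refine Set.eq_univ_of_forall fun v' => ?_
    rcases hcover v' with h | h
    · exact subset_closure h
    · exact hBA h
  haveI : IrreducibleSpace V' := by
    rw [irreducibleSpace_def, Set.top_eq_univ, ← hdense]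
    exact hA.closure
  exact isIntegral_of_irreducibleSpace_of_isReduced V'

/-- **The glued scheme is regular** when `X'` and `V` are. [folklore] -/
theorem isRegular_glue {V V' X' : Scheme.{u}} (ρ : V' ⟶ V) (e : X' ⟶ V') [IsOpenImmersion e]
    (O : V.Opens) [IsIso (ρ ∣_ O)]
    (hcover : ∀ v' : V', v' ∈ Set.range e.base ∨ ρ.base v' ∈ O)
    (hVreg : Scheme.IsRegular V) (hX'reg : Scheme.IsRegular X') : Scheme.IsRegular V' := by
  intro v'
  rcases hcover v' with ⟨x', rfl⟩ | hv'
  · haveI := hX'reg x'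
    exact IsRegularLocalRing.of_ringEquiv (asIso (e.stalkMap x')).commRingCatIsoToRingEquiv.symm
  · haveI := isIso_stalkMap_glue ρ O v' hv'
    haveI := hVreg (ρ.base v')
    exact IsRegularLocalRing.of_ringEquiv (asIso (ρ.stalkMap v')).commRingCatIsoToRingEquiv

/-- **The glued model has the dimension of the old one**: both `V'` and `V`, integral and locally
of finite type over the field `k`, contain a copy of the non-empty open `O` over which `ρ` is an
isomorphism. [folklore] -/
theorem topologicalKrullDim_glue {k : Type u} [Field k] {V V' : Scheme.{u}} [IsIntegral V]
    [IsIntegral V'] (qV : V ⟶ Spec (.of k)) [LocallyOfFiniteType qV] (q' : V' ⟶ Spec (.of k))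
    [LocallyOfFiniteType q'] (ρ : V' ⟶ V) (O : V.Opens) [IsIso (ρ ∣_ O)]
    (hne : ((ρ ⁻¹ᵁ O : V'.Opens) : Set V').Nonempty) :
    topologicalKrullDim V' = topologicalKrullDim V := by
  obtain ⟨v', hv'⟩ := hne
  have hO : (O : Set V).Nonempty := ⟨ρ.base v', hv'⟩
  rw [← topologicalKrullDim_opens_eq q' (ρ ⁻¹ᵁ O) ⟨v', hv'⟩, ← topologicalKrullDim_opens_eq qV O hO]
  exact IsHomeomorph.topologicalKrullDim_eq _ (ρ ∣_ O).homeomorph.isHomeomorph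

end Summit.ResolutionOfSingularities.ResolutionOfSingularities.Theorems.RadicialJung.CleanModels

end
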